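import Mathlib.Analysis.Normed.Module.FiniteDimension
import HarnessLib
import Literature.Geometry.DiscreteGeometry.KissingPatterns
import Literature.MathematicalPhysics.StatisticalMechanics.BarlowStacking
import Literature.MathematicalPhysics.StatisticalMechanics.LocalMatchingCompactness
import Summits.AtomisticToContinuum.Crystallization.Theorems.HullExactificationCascadeExactHcpLocalTheorem

/-!
# Line `birth` of crux `FreeSplittingCertificates.ShellRigidityHcp` (stmt-AtomisticToContinuum-12561):
# stub `stub_main` — the compactness upgrade

The lead's stub of the registered seven-stub skeleton (`Cruxes/ShellRigidityHcp/Lines/birth.lean`).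
At fixed `a, t` (`0 < a`, `|t| ≤ 1/100`), GIVEN the four neighbouring stubs as hypotheses —
the shell identification (a linear isometry `B` carries the stretched anticuboctahedral shell `S(a,t)`
onto the punctured `13/10 a`-cluster of `hcpStacking a h`, `h = (1+t)a√(2/3)`), the empty-zone property
(two constrained sites are never at distance in `(5a/4, 4a/3]`), the one-step limit lemma, and the window
transfer — we prove: for all `δ, R', ε' > 0` there are `η > 0` and `L` such that in every finite
`δ`-separated configuration, a site all of whose neighbours within `L` have `η`-close first shells has its
`R'`-window two-sidedly `ε'`-matched to `x i + A (hcpStacking a h − q)`, `q` a site, `A` a linear isometry.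

Proof (contradiction + local matching compactness). If not, for `η_n = a/(100(n+1))`, `L_n = n` there are
bad configurations `x_n` with centres `c_n`. The recentred ranges `Z_n = {x_n j − x_n c_n}` are `δ`-separated
sets containing `0`; by `exists_subseq_forall_eventually_ballMatch` a subsequence converges in the local
matching sense to a `δ`-separated `Y`, and `0 ∈ Y` (`zero_mem_of_forall_exists_norm_le`). Every `y ∈ Y`
has, for every `η' > 0`, a punctured open `13/10 a`-neighbourhood `η'`-congruent to the punctured hcp
cluster: match `y` to a particle `p = x j − x c` of a far-out approximant, whose shell and whose
neighbours' shells are `η_n`-close (`L_n → ∞`), read the empty zone off the empty-zone hypothesis, and apply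
the one-step limit lemma with tolerance `η_n + 2ε ≤ η'` (`shell_coe_eq` does the set algebra,
`shellCloseTo_image` moves the pattern by `B`). The tree's exact local theorem
`ExactHcpLocal.eq_image_hcpStacking` (route HullExactificationCascade, proved; envelope
`0.64 a² < h² < 0.69 a²` holds for `|t| ≤ 1/100`) makes `Y = g '' hcpStacking a h` for a Euclidean isometry
`g`; an eventual `BallMatch ε' R'` against `g '' hcpStacking a h`, read through the window transfer, is the
forbidden conclusion for that approximant. All `[folklore]` bookkeeping; sources: Hales, *Dense Sphere
Packings* §1.3 (layer rigidity, in the tree), Baake–Grimm 2013 Remark 5.6 (local rubber topology, in the tree).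
-/

noncomputable section

namespace Summit.AtomisticToContinuum.Crystallization.Theorems.ShellRigidityHcpBirth

open Literature.Geometry.DiscreteGeometry Literature.MathematicalPhysics.StatisticalMechanics
open Filter Topology

/-! ### Small lemmas -/

/-- In a `δ`-separated set (`δ > 0`), if there are points of arbitrarily small norm then `0` is a
point of the set. [folklore] -/
theorem zero_mem_of_forall_exists_norm_le {Y : Set (EuclideanSpace ℝ (Fin 3))} {δ : ℝ} (hδ : 0 < δ)
    (hsep : ∀ p ∈ Y, ∀ q ∈ Y, p ≠ q → δ ≤ dist p q)
    (h : ∀ ε : ℝ, 0 < ε → ∃ s ∈ Y, ‖s‖ ≤ ε) : (0 : EuclideanSpace ℝ (Fin 3)) ∈ Y := by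
  obtain ⟨s₁, hs₁, hs₁n⟩ := h (δ / 3) (by positivity)
  by_cases hs : s₁ = 0
  · rwa [hs] at hs₁
  · exfalso
    have hpos : 0 < ‖s₁‖ := norm_pos_iff.2 hs
    obtain ⟨s₂, hs₂, hs₂n⟩ := h (min (δ / 3) (‖s₁‖ / 2)) (lt_min (by positivity) (by positivity))
    have hne : s₁ ≠ s₂ := by
      intro he
      rw [← he] at hs₂n
      have := (le_min_iff.1 hs₂n).2
      linarith
    have h1 := hsep s₁ hs₁ s₂ hs₂ hne
    have h2 : dist s₁ s₂ ≤ ‖s₁‖ + ‖s₂‖ := by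
      rw [dist_eq_norm]; exact norm_sub_le _ _
    have h3 := (le_min_iff.1 hs₂n).1
    linarith

/-- Moving the pattern by a linear isometry does not change `ShellCloseTo` (compose the frame with
the inverse isometry; `ℝ³` is finite-dimensional). [folklore] -/
theorem shellCloseTo_image {η : ℝ} {T P : Finset (EuclideanSpace ℝ (Fin 3))} (B : EuclideanSpace ℝ (Fin 3) →ₗᵢ[ℝ] EuclideanSpace ℝ (Fin 3))
    (h : ShellCloseTo η T P) : ShellCloseTo η T (P.image B) := by
  obtain ⟨A, hA⟩ := h
  set Be : EuclideanSpace ℝ (Fin 3) ≃ₗᵢ[ℝ] EuclideanSpace ℝ (Fin 3) := B.toLinearIsometryEquiv rfl with hBe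
  refine ⟨A.comp Be.symm.toLinearIsometry, ?_⟩
  have himg : (P.image B).image (A.comp Be.symm.toLinearIsometry) = P.image A := by
    rw [Finset.image_image]
    congr 1
    funext u
    simp only [Function.comp_apply, LinearIsometry.coe_comp, LinearIsometryEquiv.coe_toLinearIsometry]
    congr 1
    have : B u = Be u := by rw [hBe, LinearIsometry.toLinearIsometryEquiv_apply]
    rw [this, LinearIsometryEquiv.symm_apply_apply]
  rw [himg]
  exact hA

/-- **Set algebra of recentred shells.** For an injective configuration `x`, the punctured closed
`r`-neighbourhood of the particle `x j − x i` in the recentred range `{x l − x i}`, recentred again, is the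
configuration shell of `j`. [folklore] -/
theorem shell_coe_eq {N : ℕ} (x : Fin N → EuclideanSpace ℝ (Fin 3)) (hx : Function.Injective x) (i j : Fin N) (r : ℝ) :
    (fun u => u - (x j - x i)) ''
        {u ∈ Set.range (fun l => x l - x i) | u ≠ x j - x i ∧ dist u (x j - x i) ≤ r} =
      ↑((Finset.univ.filter fun l => l ≠ j ∧ dist (x l) (x j) ≤ r).image fun l => x l - x j) := by
  ext v
  simp only [Set.mem_image, Set.mem_setOf_eq, Set.mem_range, Finset.coe_image, Finset.coe_filter,
    Finset.mem_univ, true_and]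
  constructor
  · rintro ⟨u, ⟨⟨l, rfl⟩, hne, hd⟩, rfl⟩
    refine ⟨l, ⟨fun hl => hne (by rw [hl]), ?_⟩, by abel⟩
    rwa [dist_sub_right] at hd
  · rintro ⟨l, ⟨hne, hd⟩, rfl⟩
    refine ⟨x l - x i, ⟨⟨l, rfl⟩, ?_, ?_⟩, by abel⟩
    · intro hl
      exact hne (hx (sub_left_injective hl))
    · rwa [dist_sub_right]

/-- The recentred range of a `δ`-separated configuration is a `δ`-separated set. [folklore] -/
theorem separated_range_sub {N : ℕ} {x : Fin N → EuclideanSpace ℝ (Fin 3)} {δ : ℝ} (c : EuclideanSpace ℝ (Fin 3))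
    (hsep : ∀ i j, i ≠ j → δ ≤ dist (x i) (x j)) :
    ∀ p ∈ Set.range (fun l => x l - c), ∀ q ∈ Set.range (fun l => x l - c), p ≠ q → δ ≤ dist p q := by
  rintro _ ⟨l, rfl⟩ _ ⟨l', rfl⟩ hne
  have hll' : l ≠ l' := fun h => hne (by rw [h])
  rw [dist_sub_right]
  exact hsep l l' hll'

/-! ### The compactness upgrade -/

/-- **stub_main** (the compactness upgrade of line `birth`, crux `ShellRigidityHcp`): see the module
docstring. [folklore] -/
theorem stub_main :
    ∀ a t : ℝ, 0 < a → |t| ≤ 1 / 100 →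
      (∃ B : EuclideanSpace ℝ (Fin 3) →ₗᵢ[ℝ] EuclideanSpace ℝ (Fin 3),
        (↑((hcpKissingPattern.image fun u =>
              a • (u + (t * (u 0 + u 1 + u 2) / 3) • intVec ![1, 1, 1])).image B) :
            Set (EuclideanSpace ℝ (Fin 3))) =
          {p : EuclideanSpace ℝ (Fin 3) |
            p ∈ hcpStacking a ((1 + t) * a * Real.sqrt (2 / 3)) ∧ p ≠ 0 ∧ ‖p‖ < 13 / 10 * a}) →
      (∀ η : ℝ, η ≤ a / 100 →
        ∀ (N : ℕ) (x : Fin N → EuclideanSpace ℝ (Fin 3)) (k j : Fin N),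
          ShellCloseTo η
            ((Finset.univ.filter fun l => l ≠ k ∧ dist (x l) (x k) ≤ 5 * a / 4).image fun l => x l - x k)
            (hcpKissingPattern.image fun u => a • (u + (t * (u 0 + u 1 + u 2) / 3) • intVec ![1, 1, 1])) →
          ShellCloseTo η
            ((Finset.univ.filter fun l => l ≠ j ∧ dist (x l) (x j) ≤ 5 * a / 4).image fun l => x l - x j)
            (hcpKissingPattern.image fun u => a • (u + (t * (u 0 + u 1 + u 2) / 3) • intVec ![1, 1, 1])) →
          j ≠ k → dist (x j) (x k) ≤ 4 * a / 3 → dist (x j) (x k) ≤ 5 * a / 4) →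
      (∀ (a δ ε η : ℝ) (P : Finset (EuclideanSpace ℝ (Fin 3))) (Z Y : Set (EuclideanSpace ℝ (Fin 3)))
        (y p : EuclideanSpace ℝ (Fin 3)),
        0 < a → 0 < δ → 0 < ε → 3 * ε ≤ δ → ε ≤ a / 100 →
        (∀ u ∈ Z, ∀ v ∈ Z, u ≠ v → δ ≤ dist u v) →
        (∀ u ∈ Y, ∀ v ∈ Y, u ≠ v → δ ≤ dist u v) →
        BallMatch ε (‖y‖ + 2 * a) 0 Z Y →
        y ∈ Y → p ∈ Z → dist p y ≤ ε →
        (∃ T : Finset (EuclideanSpace ℝ (Fin 3)),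
          (↑T : Set (EuclideanSpace ℝ (Fin 3))) =
              (fun u => u - p) '' {u ∈ Z | u ≠ p ∧ dist u p ≤ 5 * a / 4} ∧
            ShellCloseTo η T P) →
        (∀ u ∈ Z, u ≠ p → dist u p ≤ 4 * a / 3 → dist u p ≤ 5 * a / 4) →
        ∃ A : EuclideanSpace ℝ (Fin 3) →ₗᵢ[ℝ] EuclideanSpace ℝ (Fin 3),
          ∃ e : ↥{z : EuclideanSpace ℝ (Fin 3) | z ∈ Y ∧ z ≠ y ∧ dist z y < 13 / 10 * a} ≃ ↥P,
            ∀ z : ↥{z : EuclideanSpace ℝ (Fin 3) | z ∈ Y ∧ z ≠ y ∧ dist z y < 13 / 10 * a},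
              dist ((z : EuclideanSpace ℝ (Fin 3)) - y) (A ((e z : ↥P) : EuclideanSpace ℝ (Fin 3))) ≤
                η + 2 * ε) →
      (∀ (Λ Z : Set (EuclideanSpace ℝ (Fin 3)))
        (g : EuclideanSpace ℝ (Fin 3) ≃ᵢ EuclideanSpace ℝ (Fin 3)) (ε' R' : ℝ),
        (0 : EuclideanSpace ℝ (Fin 3)) ∈ g '' Λ → BallMatch ε' R' 0 Z (g '' Λ) →
        ∃ q ∈ Λ, ∃ A : EuclideanSpace ℝ (Fin 3) →ₗᵢ[ℝ] EuclideanSpace ℝ (Fin 3),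
          (∀ p ∈ Λ, dist p q ≤ R' → ∃ z ∈ Z, dist z (A (p - q)) ≤ ε') ∧
          (∀ z ∈ Z, ‖z‖ ≤ R' → ∃ p ∈ Λ, dist z (A (p - q)) ≤ ε')) →
      ∀ δ R' ε' : ℝ, 0 < δ → 0 < R' → 0 < ε' → ∃ η : ℝ, 0 < η ∧ ∃ L : ℝ,
        ∀ (N : ℕ) (x : Fin N → EuclideanSpace ℝ (Fin 3)),
          (∀ i j, i ≠ j → δ ≤ dist (x i) (x j)) →
          ∀ i : Fin N,
            (∀ k : Fin N, dist (x k) (x i) ≤ L →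
              ShellCloseTo η
                ((Finset.univ.filter fun j => j ≠ k ∧ dist (x j) (x k) ≤ 5 * a / 4).image
                  fun j => x j - x k)
                (hcpKissingPattern.image fun u =>
                  a • (u + (t * (u 0 + u 1 + u 2) / 3) • intVec ![1, 1, 1]))) →
            ∃ q ∈ hcpStacking a ((1 + t) * a * Real.sqrt (2 / 3)),
              ∃ A : EuclideanSpace ℝ (Fin 3) →ₗᵢ[ℝ] EuclideanSpace ℝ (Fin 3),
                (∀ p ∈ hcpStacking a ((1 + t) * a * Real.sqrt (2 / 3)), dist p q ≤ R' →
                  ∃ j, dist (x j) (x i + A (p - q)) ≤ ε') ∧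
                (∀ j, dist (x j) (x i) ≤ R' →
                  ∃ p ∈ hcpStacking a ((1 + t) * a * Real.sqrt (2 / 3)),
                    dist (x j) (x i + A (p - q)) ≤ ε') := by
  intro a t ha ht hB hEZ hLS hWT δ R' ε' hδ hR' hε'
  -- abbreviations
  set h : ℝ := (1 + t) * a * Real.sqrt (2 / 3) with hh_def
  set S : Finset (EuclideanSpace ℝ (Fin 3)) := (hcpKissingPattern.image fun u =>
    a • (u + (t * (u 0 + u 1 + u 2) / 3) • intVec ![1, 1, 1])) with hS_def
  obtain ⟨B, hBimg⟩ := hB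
  -- the envelope of the exact local theorem
  have h1t : 99 / 100 ≤ 1 + t ∧ 1 + t ≤ 101 / 100 := by
    obtain ⟨h1, h2⟩ := abs_le.mp ht
    constructor <;> linarith
  have hs23 : Real.sqrt (2 / 3) ^ 2 = 2 / 3 := Real.sq_sqrt (by norm_num)
  have hh2 : h ^ 2 = (1 + t) ^ 2 * a ^ 2 * (2 / 3) := by rw [hh_def]; ring_nf; rw [hs23]; ring
  have hh0 : 0 < h := by
    rw [hh_def]
    exact mul_pos (mul_pos (by linarith [h1t.1]) ha) (Real.sqrt_pos.2 (by norm_num))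
  have ha2 : 0 < a ^ 2 := by positivity
  have hsqlo : 9801 / 10000 ≤ (1 + t) ^ 2 := by nlinarith [h1t.1, h1t.2]
  have hsqhi : (1 + t) ^ 2 ≤ 10201 / 10000 := by nlinarith [h1t.1, h1t.2]
  have hhlo : 64 / 100 * a ^ 2 < h ^ 2 := by
    rw [hh2]
    have := mul_le_mul_of_nonneg_right hsqlo ha2.le
    linarith
  have hhhi : h ^ 2 < 69 / 100 * a ^ 2 := by
    rw [hh2]
    have := mul_le_mul_of_nonneg_right hsqhi ha2.le
    linarith
  -- contradiction hypothesis, as a sequence of bad configurations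
  by_contra hcon
  have key : ∀ n : ℕ, ∃ (N : ℕ) (x : Fin N → EuclideanSpace ℝ (Fin 3)) (i : Fin N),
      (∀ i j, i ≠ j → δ ≤ dist (x i) (x j)) ∧
      (∀ k, dist (x k) (x i) ≤ (n : ℝ) →
        ShellCloseTo (a / (100 * ((n : ℝ) + 1)))
          ((Finset.univ.filter fun j => j ≠ k ∧ dist (x j) (x k) ≤ 5 * a / 4).image fun j => x j - x k)
          S) ∧
      ¬ (∃ q ∈ hcpStacking a h, ∃ A : EuclideanSpace ℝ (Fin 3) →ₗᵢ[ℝ] EuclideanSpace ℝ (Fin 3),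
          (∀ p ∈ hcpStacking a h, dist p q ≤ R' → ∃ j, dist (x j) (x i + A (p - q)) ≤ ε') ∧
          (∀ j, dist (x j) (x i) ≤ R' → ∃ p ∈ hcpStacking a h, dist (x j) (x i + A (p - q)) ≤ ε')) := by
    intro n
    by_contra hn
    apply hcon
    refine ⟨a / (100 * ((n : ℝ) + 1)), by positivity, n, ?_⟩
    intro N x hsep i hshell
    by_contra hc
    exact hn ⟨N, x, i, hsep, hshell, hc⟩
  choose Nn xn cn hsep hshell hnot using key
  have hxinj : ∀ n, Function.Injective (xn n) := by
    intro n i j hij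
    by_contra hne
    have := hsep n i j hne
    rw [hij, dist_self] at this
    linarith
  have hdist : ∀ u v w : EuclideanSpace ℝ (Fin 3), dist (u - v) w = dist u (v + w) := fun u v w => by
    rw [dist_eq_norm, dist_eq_norm, sub_sub]
  have hηle : ∀ n : ℕ, a / (100 * ((n : ℝ) + 1)) ≤ a / 100 := fun n =>
    div_le_div_of_nonneg_left ha.le (by positivity) (by nlinarith [n.cast_nonneg (α := ℝ)])
  -- the recentred ranges and their local limit
  set Z : ℕ → Set (EuclideanSpace ℝ (Fin 3)) := fun n => Set.range (fun l => xn n l - xn n (cn n)) with hZ_def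
  have hZsep : ∀ n, ∀ p ∈ Z n, ∀ q ∈ Z n, p ≠ q → δ ≤ dist p q := fun n =>
    separated_range_sub (xn n (cn n)) (hsep n)
  have h0Z : ∀ n, (0 : EuclideanSpace ℝ (Fin 3)) ∈ Z n := fun n => ⟨cn n, sub_self _⟩
  obtain ⟨φ, Y, hφ, hYsep, hlim⟩ := exists_subseq_forall_eventually_ballMatch hδ Z hZsep
  have hφt : Tendsto (fun k => (φ k : ℝ)) atTop atTop :=
    tendsto_natCast_atTop_atTop.comp hφ.tendsto_atTop
  -- `0 ∈ Y`
  have h0Y : (0 : EuclideanSpace ℝ (Fin 3)) ∈ Y := by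
    refine zero_mem_of_forall_exists_norm_le hδ hYsep fun ε hε => ?_
    obtain ⟨k, hk⟩ := (hlim 0 ε hε).exists
    obtain ⟨s, hs, hds⟩ := hk.2 0 (h0Z (φ k)) (by simp)
    refine ⟨s, hs, ?_⟩
    rwa [dist_comm, dist_zero_right] at hds
  -- every point of `Y` has an exact punctured hcp cluster
  have hloc : ∀ y ∈ Y, ∀ η' : ℝ, 0 < η' → ∃ A : EuclideanSpace ℝ (Fin 3) →ₗᵢ[ℝ] EuclideanSpace ℝ (Fin 3),
      ∃ e : ↥{z : EuclideanSpace ℝ (Fin 3) | z ∈ Y ∧ z ≠ y ∧ dist z y < 13 / 10 * a} ≃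
        ↥{p : EuclideanSpace ℝ (Fin 3) | p ∈ hcpStacking a h ∧ p ≠ 0 ∧ ‖p‖ < 13 / 10 * a},
      ∀ z : ↥{z : EuclideanSpace ℝ (Fin 3) | z ∈ Y ∧ z ≠ y ∧ dist z y < 13 / 10 * a},
        dist ((z : EuclideanSpace ℝ (Fin 3)) - y)
          (A ((e z : ↥{p : EuclideanSpace ℝ (Fin 3) | p ∈ hcpStacking a h ∧ p ≠ 0 ∧ ‖p‖ < 13 / 10 * a}) : EuclideanSpace ℝ (Fin 3))) ≤ η' := by
    intro y hy η' hη'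
    -- tolerances
    set ε : ℝ := min (δ / 3) (min (a / 100) (η' / 3)) with hε_def
    have hε0 : 0 < ε := lt_min (by positivity) (lt_min (by positivity) (by positivity))
    have hεδ : 3 * ε ≤ δ := by
      have := min_le_left (δ / 3) (min (a / 100) (η' / 3)); linarith
    have hεa : ε ≤ a / 100 := (min_le_right _ _).trans (min_le_left _ _)
    have hεη : ε ≤ η' / 3 := (min_le_right _ _).trans (min_le_right _ _)
    -- a good index: ball matching on radius `‖y‖ + 2a`, large `L_n`, small `η_n`
    have hev2 : ∀ᶠ k in atTop, ‖y‖ + 2 * a ≤ (φ k : ℝ) ∧ a / (100 * ((φ k : ℝ) + 1)) ≤ η' / 3 := by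
      refine (hφt.eventually_ge_atTop (max (‖y‖ + 2 * a) (3 * a / (100 * η')))).mono
        fun k hk => ⟨(le_max_left _ _).trans hk, ?_⟩
      have hk' : 3 * a / (100 * η') ≤ (φ k : ℝ) := (le_max_right _ _).trans hk
      rw [div_le_iff₀ (by positivity)] at hk'
      rw [div_le_div_iff₀ (by positivity) (by positivity)]
      nlinarith
    obtain ⟨k, hBM, hkL, hkη⟩ := ((hlim (‖y‖ + 2 * a) ε hε0).and hev2).exists
    set n := φ k with hn_def
    -- the particle near `y`
    obtain ⟨p, hpZ, hpy⟩ := hBM.1 y hy (by rw [dist_zero_right]; linarith)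
    obtain ⟨j, hj⟩ : ∃ j, xn n j - xn n (cn n) = p := hpZ
    have hnp : ‖p‖ ≤ ‖y‖ + ε := by
      have := dist_triangle p y 0
      rw [dist_zero_right, dist_zero_right] at this
      linarith
    have hjc : dist (xn n j) (xn n (cn n)) ≤ (n : ℝ) := by
      rw [dist_eq_norm, hj]; linarith [hεa]
    -- its shell, as the punctured `5a/4`-neighbourhood of `p` in `Z n`
    have hTclose := shellCloseTo_image B (hshell n j hjc)
    have hT : (↑((Finset.univ.filter fun l => l ≠ j ∧ dist (xn n l) (xn n j) ≤ 5 * a / 4).image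
        fun l => xn n l - xn n j) : Set (EuclideanSpace ℝ (Fin 3))) =
        (fun u => u - p) '' {u ∈ Z n | u ≠ p ∧ dist u p ≤ 5 * a / 4} := by
      rw [← hj]
      exact (shell_coe_eq (xn n) (hxinj n) (cn n) j (5 * a / 4)).symm
    -- the empty zone about `p`
    have hzone : ∀ u ∈ Z n, u ≠ p → dist u p ≤ 4 * a / 3 → dist u p ≤ 5 * a / 4 := by
      rintro _ ⟨l, rfl⟩ hne hd
      rw [← hj] at hne hd ⊢
      have hlj : l ≠ j := fun hl => hne (by rw [hl])
      rw [dist_sub_right] at hd ⊢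
      have hlc : dist (xn n l) (xn n (cn n)) ≤ (n : ℝ) := by
        have h1 := dist_triangle (xn n l) (xn n j) (xn n (cn n))
        have h2 : dist (xn n j) (xn n (cn n)) ≤ ‖y‖ + ε := by rw [dist_eq_norm, hj]; exact hnp
        linarith
      exact hEZ _ (hηle n) (Nn n) (xn n) j l (hshell n j hjc) (hshell n l hlc) hlj hd
    -- the one-step limit lemma
    obtain ⟨A, e, hAe⟩ := hLS a δ ε (a / (100 * ((n : ℝ) + 1))) (S.image B) (Z n) Y y p ha hδ hε0
      hεδ hεa (hZsep n) hYsep hBM hy ⟨j, hj⟩ hpy ⟨_, hT, hTclose⟩ hzone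
    have hmem : ∀ w : EuclideanSpace ℝ (Fin 3), w ∈ S.image B ↔
        w ∈ {p : EuclideanSpace ℝ (Fin 3) | p ∈ hcpStacking a h ∧ p ≠ 0 ∧ ‖p‖ < 13 / 10 * a} := fun w => by
      rw [← hBimg, Finset.mem_coe]
    refine ⟨A, e.trans (Equiv.subtypeEquivRight hmem), fun z => ?_⟩
    rw [Equiv.trans_apply, Equiv.subtypeEquivRight_apply_coe]
    have := hAe z
    linarith
  -- the exact local theorem: `Y` is a moved stretched hcp crystal
  obtain ⟨g, hYg⟩ := ExactHcpLocal.eq_image_hcpStacking ha hh0 hhlo hhhi ⟨0, h0Y⟩ hloc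
  -- an eventual window matching contradicts the choice of the sequence
  obtain ⟨k, hBM⟩ := (hlim R' ε' hε').exists
  set n := φ k with hn_def
  have h0g : (0 : EuclideanSpace ℝ (Fin 3)) ∈ g '' hcpStacking a h := hYg ▸ h0Y
  rw [hYg] at hBM
  obtain ⟨q, hq, A, hA1, hA2⟩ := hWT (hcpStacking a h) (Z n) g ε' R' h0g hBM
  refine hnot n ⟨q, hq, A, fun p' hp' hd => ?_, fun j hj => ?_⟩
  · obtain ⟨z, ⟨j, rfl⟩, hz⟩ := hA1 p' hp' hd
    exact ⟨j, by rwa [hdist] at hz⟩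
  · obtain ⟨p', hp', hz⟩ := hA2 (xn n j - xn n (cn n)) ⟨j, rfl⟩ (by rwa [← dist_eq_norm])
    exact ⟨p', hp', by rwa [hdist] at hz⟩

end Summit.AtomisticToContinuum.Crystallization.Theorems.ShellRigidityHcpBirth

end
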